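import Summits.ResolutionOfSingularities.ResolutionOfSingularities.Theses.WeightedInvariant
import Summits.ResolutionOfSingularities.ResolutionOfSingularities.Theorems.WeightedInvariantDescentReducedToIntegral
import Summits.ResolutionOfSingularities.ResolutionOfSingularities.Theorems.WeightedInvariantWeightedThesisFBlowupExists
import Summits.ResolutionOfSingularities.ResolutionOfSingularities.Theorems.WeightedInvariantWeightedThesisTowerExists
import Summits.ResolutionOfSingularities.ResolutionOfSingularities.Theorems.WeightedInvariantWeightedThesisKunzFlat
import Summits.ResolutionOfSingularities.ResolutionOfSingularities.Theorems.WeightedInvariantWeightedThesisKunzIso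
import Summits.ResolutionOfSingularities.ResolutionOfSingularities.Theorems.WeightedInvariantWeightedThesisNormalizationIso
import Summits.ResolutionOfSingularities.ResolutionOfSingularities.Theorems.WeightedInvariantWeightedThesisLocalToGlobal
import Literature.AlgebraicGeometry.Resolution.BlowupsFlatBaseChange

/-!
# ResolutionOfSingularities / WeightedInvariant — `WeightedThesis`, line `kunz-tower-exceptional-defect`:
# the transfer theorem (termination of the normalised F-blowup tower ⇒ the crux)

Support file for `stmt-ResolutionOfSingularities-0569` (stub `stub_weightedThesis_of_pointwiseTermination`
of the lead skeleton `Cruxes/WeightedThesis/Lines/kunz_tower_exceptional_defect.lean`). It assembles the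
six landed stubs of the line — existence of F-blowups (`stub_fblowupExists`), normalised F-blowup
towers with proper birational stages (`stub_towerExists`), Kunz's theorem "regular ⇒ Frobenius flat"
(`stub_kunzFlat`), F-blowups are isomorphisms over the regular locus (`stub_kunzIso`), the
normalisation is an isomorphism over regular opens (`stub_normalizationIso`), local-to-global
termination (`stub_localToGlobal`) — into the implication

  POINTWISE TERMINATION OF THE NORMALISED F-BLOWUP TOWER (normalised form of Yasuda 2012,
  Question 1.4, for varieties over perfect fields)  ⇒  `WeightedThesis`

(resolution of every reduced separated scheme of finite type over every perfect field of
characteristic `p`). The hypothesis is spelled out verbatim (it is the one OPEN stub of the line,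
`stub_pointwiseTermination`); no definition is introduced. Reduced ⇒ integral by the landed
`descentReducedToIntegral_proof` (stmt-0551).

Sources: T. Yasuda, *Universal flattening of Frobenius*, Amer. J. Math. 134 (2012) = arXiv:0706.2700,
Question 1.4, Cor. 2.6, Prop. 2.7; N. Hara, T. Sawada, T. Yasuda, *F-blowups of normal surface
singularities*, arXiv:1108.1840 (status of the question); E. Kunz, Amer. J. Math. 91 (1969), Thm. 2.1.
-/

-- single-problem summit: the doubled namespace component `ResolutionOfSingularities` is forced
set_option linter.dupNamespace false

noncomputable section

open CategoryTheory CategoryTheory.Limits AlgebraicGeometry TopologicalSpace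
open Literature.AlgebraicGeometry.Resolution
open Summit.ResolutionOfSingularities.ResolutionOfSingularities.Theses.WeightedInvariant

namespace Summit.ResolutionOfSingularities.ResolutionOfSingularities.Theorems.WeightedThesis.KunzTower

/-- **The steps of a normalised F-blowup tower are isomorphisms over regular opens**: if
`π = i ≫ normalizationι Y ≫ g` with `g` an `e`-th F-blowup (`e ≥ 1`) of the integral `W`
(locally of finite type over a perfect field of characteristic `p`) and `i` an isomorphism, then
`π` restricts to an isomorphism over every open `U ⊆ Reg W` — over `U` the F-blowup is an
isomorphism (Kunz: `stub_kunzFlat` + `stub_kunzIso`), so `g⁻¹ U ≅ U` is regular and the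
normalisation is an isomorphism over it (`stub_normalizationIso`).
[cite: Yasuda2012, Cor. 2.6 and Prop. 2.7] -/
theorem isIso_normalizedFBlowupStep_restrict {p : ℕ} [Fact p.Prime] {k : Type} [Field k]
    [CharP k p] [PerfectField k] {e : ℕ} (he : 0 < e) {W Z : Scheme.{0}}
    (fW : W ⟶ Spec (.of k)) [IsIntegral W] [LocallyOfFiniteType fW] [CharP W.functionField p]
    (π : Z ⟶ W)
    (h : ∃ (Y : Scheme.{0}) (_ : IsIntegral Y) (g : Y ⟶ W) (i : Z ≅ normalization Y),
      IsFBlowup p e g ∧ π = i.hom ≫ normalizationι Y ≫ g)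
    (U : W.Opens) (hU : (U : Set W) ⊆ Scheme.regularLocus W) : IsIso (π ∣_ U) := by
  obtain ⟨Y, hY, g, i, hg, rfl⟩ := h
  -- the isomorphism factor first (before heavier `IsIso` facts enter the local context)
  have h1 : IsIso (i.hom ∣_ (normalizationι Y ≫ g) ⁻¹ᵁ U) := inferInstance
  -- the F-blowup is an isomorphism over `U` (Kunz)
  have hgU : IsIso (g ∣_ U) :=
    stub_kunzIso (fun p _ R _ _ _ => stub_kunzFlat p R) p k e he W Y fW g hg U hU
  -- `Y` is locally of finite type over `k` (the F-blowup is proper)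
  haveI : IsLocallyNoetherian W := LocallyOfFiniteType.isLocallyNoetherian fW
  haveI : IsProper g := hg.isProper
  haveI : LocallyOfFiniteType (g ≫ fW) := inferInstance
  -- `g ⁻¹ U` lies in the regular locus of `Y`
  have hV : ((g ⁻¹ᵁ U : Y.Opens) : Set Y) ⊆ Scheme.regularLocus Y := by
    intro y hy
    exact (@mem_regularLocus_iff_of_isIso_morphismRestrict _ _ g U hgU y hy).mpr (hU hy)
  -- the normalisation is an isomorphism over it
  have hνV : IsIso (normalizationι Y ∣_ g ⁻¹ᵁ U) :=
    stub_normalizationIso k Y (g ≫ fW) (g ⁻¹ᵁ U) hV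
  -- assemble
  rw [morphismRestrict_comp, morphismRestrict_comp]
  exact @IsIso.comp_isIso _ _ _ _ _ _ _ h1 (@IsIso.comp_isIso _ _ _ _ _ _ _ hνV hgU)

/-- **TRANSFER THEOREM of line `kunz-tower-exceptional-defect`** (stub
`stub_weightedThesis_of_pointwiseTermination`): if for every integral separated scheme `X₀` of
finite type over a perfect field of characteristic `p` there is a level `e ≥ 1` such that every
normalised F-blowup tower of level `e` over `X₀` becomes regular above each closed point of `X₀`
at some stage (the normalised form of Yasuda's Question 1.4 — OPEN), then `WeightedThesis` holds:
every reduced separated scheme of finite type over every perfect field of characteristic `p` has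
a resolution of singularities. Proof: integral case — take the level `e`, a tower of level `e`
with proper birational stages (`stub_towerExists` fed by `stub_fblowupExists`), its pointwise
termination (the hypothesis), globalise (`stub_localToGlobal`, whose isomorphism hypothesis is
`isIso_normalizedFBlowupStep_restrict`), and transport the resolution of the regular stage along
the proper birational `ρ n` (`Scheme.HasResolution.of_isBirational`); reduced case —
`descentReducedToIntegral_proof`. [cite: Yasuda2012, Question 1.4 and Cor. 2.6] -/
theorem stub_weightedThesis_of_pointwiseTermination :
    (∀ (p : ℕ) [Fact p.Prime] (k : Type) [Field k] [CharP k p] [PerfectField k]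
      (X₀ : Scheme.{0}) (f : X₀ ⟶ Spec (.of k)) [IsIntegral X₀] [IsSeparated f]
      [LocallyOfFiniteType f] [QuasiCompact f] [CharP X₀.functionField p],
      ∃ e : ℕ, 0 < e ∧
        ∀ (X : ℕ → Scheme.{0}) [∀ n, IsIntegral (X n)] [∀ n, CharP (X n).functionField p]
          (ρ : ∀ n, X n ⟶ X₀) (π : ∀ n, X (n + 1) ⟶ X n),
          (∀ n, π n ≫ ρ n = ρ (n + 1)) →
          (∃ (Y : Scheme.{0}) (_ : IsIntegral Y) (g : Y ⟶ X₀) (i : X 0 ≅ normalization Y),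
              IsFBlowup p e g ∧ ρ 0 = i.hom ≫ normalizationι Y ≫ g) →
          (∀ n, ∃ (Y : Scheme.{0}) (_ : IsIntegral Y) (g : Y ⟶ X n)
              (i : X (n + 1) ≅ normalization Y),
              IsFBlowup p e g ∧ π n = i.hom ≫ normalizationι Y ≫ g) →
          ∀ x : X₀, IsClosed ({x} : Set X₀) →
            ∃ n, ∀ y : X n, ρ n y = x → y ∈ Scheme.regularLocus (X n)) →
    WeightedThesis := by
  intro hPT p hp k _ _ _ X f hsep hlft hqc hred
  haveI : Fact p.Prime := ⟨hp⟩
  refine Summit.ResolutionOfSingularities.ResolutionOfSingularities.Theorems.descentReducedToIntegral_proof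
    k (fun X₀ f₀ hsep₀ hlft₀ hqc₀ hint₀ => ?_) X f hsep hlft hqc hred
  haveI := hsep₀; haveI := hlft₀; haveI := hqc₀; haveI := hint₀
  haveI : CharP X₀.functionField p := charP_functionField_of_hom p f₀
  -- the level and the tower
  obtain ⟨e, he, hterm⟩ := hPT p k X₀ f₀
  obtain ⟨T, hTint, hTchar, ρ, π, hρ, h0, hstep, hstage⟩ :=
    stub_towerExists p k e he (fun X f _ _ _ _ _ => stub_fblowupExists p k X f e he) X₀ f₀
  -- steps are isomorphisms over regular opens
  have hiso : ∀ n (U : (T n).Opens), (U : Set (T n)) ⊆ Scheme.regularLocus (T n) →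
      IsIso (π n ∣_ U) := by
    intro n U hU
    haveI : IsProper (ρ n) := (hstage n).1
    haveI : LocallyOfFiniteType (ρ n ≫ f₀) := inferInstance
    exact isIso_normalizedFBlowupStep_restrict he (ρ n ≫ f₀) (π n) (hstep n) U hU
  -- globalise the pointwise termination
  obtain ⟨n, hn⟩ := stub_localToGlobal k X₀ f₀ T ρ π hρ (fun n => (hstage n).1) hiso
    (hterm T ρ π hρ h0 hstep)
  -- descend the resolution along `ρ n`
  haveI : IsProper (ρ n) := (hstage n).1
  exact Scheme.HasResolution.of_isBirational (ρ n) (hstage n).2 hn.hasResolution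

end Summit.ResolutionOfSingularities.ResolutionOfSingularities.Theorems.WeightedThesis.KunzTower

end
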